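import Mathlib
import Literature.Geometry.Lorentzian.GiorgiKlainermanSzeftel2022.AbarDecayInteriorLedger

/-!
# Giorgi–Klainerman–Szeftel, Part II: the printed DECAY RATES (τ-exponents) of §11.7.3, §12.4.2 and Prop 12.4.6, as linear ℚ-arithmetic

CITATION HEADER (lean-in-tree rule 2026-08-18).  Kernel-checked transcription of the RATE bookkeeping — the exponents `a` in the
displayed bounds `… ≲ ε₀²τ^{a}` — of three places of Part II of
* [J]  E. Giorgi, S. Klainerman, J. Szeftel, *Wave equations estimates and the nonlinear stability of slowly rotating Kerr
  black holes*, Pure Appl. Math. Q. **20** (2024) no. 7, 2865–3849 = bib key `GiorgiKlainermanSzeftel2024` — the PRIMARY text,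
  read in the held per-page text of `doi:10.4310/pamq.241128023033` (`[J] p.N Lm` = per-page file N, line m; PDF page N, the
  printed folio is N−1);
* [v1] arXiv:2205.14808v1, TeX source `FinalKerrarxivversion.tex` (`l.N`) = bib key `GiorgiKlainermanSzeftel2022` — quoted
  beside it; the two [v1]→[J] differences met in THIS range are recorded where they are used (`nerr_v1_sign`, `nerr_v1_trap`);
* [53] of [J] = S. Klainerman, J. Szeftel, *Global nonlinear stability of Schwarzschild spacetime under polarized perturbations*
  (2020) = bib key `KlainermanSzeftel2020`, entering only through [J]'s own pointers "the standard mean value procedure, see for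
  instance the statement and proof of Theorem 5.21 in [53]" ([J] p.587 L98–99) and "the basic mean value theorem argument … as in
  the proof of Theorem 5.22 in [53]" ([J] p.530 L48–50); nothing of [53] is quoted or used as a hypothesis here.
The three places: (1) [J] §11.7.3 = [v1] §11.7, proof of Theorem M1 on `τ ≤ τ_* − 2`, Steps 1–9 ([J] p.530 L20–p.533 L37;
[v1] l.22396–22550); (2) [J] §12.4.2, proof of Lemma 12.4.8 (= Lemma 12.2.6, the `Ñ_err` term) at `s = 0` ([J] p.586 L46–p.587
L89; [v1] l.24338–24368); (3) [J] Prop 12.4.6, Steps 1–8 ([J] p.587 L90–p.591 L81; [v1] l.24371–24560).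

This is the RATE twin of the LEVEL (derivative-order) ledgers `TheoremM1M2Ledger` (§1: §11.7.3 Steps 1–10, §3: Prop 12.4.6),
`FullRWInteriorLedger` and `AbarDecayInteriorLedger`: those modules fix, display by display, the ORDER `s ≤ k_L − j`; this one
fixes the EXPONENT of `τ`.  It redeclares nothing of theirs: the printed `δ_extra = (3δ_dec − 2δ)/2` is USED as
`TheoremM1M2Ledger.dextraA`, the doubling `2·(−1 − (3/2)δ_dec + (p+δ)/2) = −2 − 3δ_dec + p + δ` as
`AbarDecayInteriorLedger.cor1225_exponent`, the bootstrap convention `ε = ε₀^{2/3}` as `AbarDecayInteriorLedger.eps_convention`.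

WHAT IS RECORDED, and how.
* §0 two BOOKKEEPING RULES that the printed exponents obey, stated as plain ℚ-functions (our reading of "the standard mean value
  procedure" of the `r^p`-hierarchy, [folklore]; NOT a quotation and NOT an estimate): `descend r p_high p_low = r − (p_high − p_low)`
  (going down the hierarchy from weight `p_high`, where the rate is `r`, to weight `p_low` gains `p_high − p_low` powers of `τ`) and
  `pigeonhole r = r − 1` (extracting a dyadic sequence of times from a time-integrated bound gains one power).  Every printed
  instance below is then a THEOREM "printed exponent = `descend …`" or "= `pigeonhole …`", so the reader sees exactly which
  displays follow the rule, with which inputs.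
* §1 [J] §11.7.3 Steps 1–9: (11.7.5) `−(2−p−δ)`; Step 2's absorption and its two smallness conditions; the mean-value range
  `−1+3δ_dec ≤ q ≤ 3δ_dec` and `−(3δ_dec − q)`; Step 3 `q = −δ`; Step 4: the ORIGIN of the printed range "`3δ_dec + 2δ ≤ p`"
  (`m1r_s4_range`: it is exactly the condition under which `ε₀²τ^{−(2−2δ)}` is absorbed by `ε₀²τ^{−(2+3δ_dec−p)}`), (11.7.6) as a
  descent from Step 3's `E_{2−δ}` rate, (11.7.7); Step 5's midpoint interpolation `−(1+3δ_dec)`; Steps 6–7; (11.7.12)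
  `−(2+3δ_dec−2δ)` as a descent; Step 9's two products with `δ_extra`.
* §2 [J] §12.4.2 (proof of Lemma 12.4.8, `s = 0`): the squares of the hypotheses (12.1.1)–(12.1.2) as the two interpolation
  endpoints, the `θ`-interpolation with `θ(1+2δ_dec) = p+δ` (the displayed `r`- and `τ`-exponents `−1−δ` and `2+2δ_dec−(p+δ)`
  follow EXACTLY, the former with the `r²` of the volume element), the integrability condition, the total `−2−4δ_dec+(p+δ)`
  against the printed `−2−3δ_dec+(p+δ)` (slack `δ_dec`), the trapped-region term, the final maximum.
* §3 [J] Prop 12.4.6 Steps 1–8: (12.4.11) `−1+2δ` and (12.4.17) `−2+4δ` as descents, the ORIGIN of the printed `p`-ranges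
  "`δ ≤ p ≤ 1−δ`" / "`δ ≤ p ≤ 1+δ`" of Step 5 (`m2r_s5_ranges`), (12.4.15) (stated WITHOUT the pigeonhole gain that Step 8 takes —
  consistent, recorded), Step 7 item 4's three exponents and the EXACT equivalence behind "Choosing `δ > 0` such that `2δ ≤ δ_dec`"
  (`m2r_s7_choice`), Step 8's two pigeonhole gains `−2−2δ_dec ↦ −3−2δ_dec`.
* §4 PRINT DATA met in this range, each as an `↔` or an inequality over ℚ: (D1) [J] p.532 L80–83 = [v1] l.22517–22522 display the
  `Σ_*`-flux with exponent `−(2+3δ_dec−3δ)` between (11.7.12)'s `−(2+3δ_dec−2δ)` and the concluded `−2−2δ_extra`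
  (`= −(2+3δ_dec−2δ)` exactly): the displayed exponent is a (weaker) consequence of (11.7.12), and the concluded one follows from
  (11.7.12) with the printed definitions of the norms (§6.1.5 items 3, 7, 8, 11: `F_p ⊆ BEF_p`, `F_{Σ_*} ∋ ∫|∇₃ψ|²`), NOT from the
  display as printed unless `δ ≤ 0` (`m1r_D1_hence_iff`) — both texts; (D2) [v1] l.24360 prints `ε₀²τ₁^{−2−3δ_dec−(p+δ)}` where its
  own previous line gives `+(p+δ)` and [J] p.587 L59–66 prints `+(p+δ)` (`nerr_v1_sign`); (D3) [v1] l.24346 prints the trapped term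
  as `ε⁴τ₁^{−2−3δ_dec} ≲ ε₀²τ₁^{−2−3δ_dec}` where [J] p.586 L71–75 prints `ε²τ₁^{−1−2δ_dec} ≲ ε₀τ₁^{−1−2δ_dec}` (`nerr_v1_trap`:
  either is dominated in the final maximum).  D2 and D3 are [v1]→[J] corrections; D1 stands in both texts and is harmless.

NOT RECORDED (deliberately): any estimate, norm, spacetime or PDE object — the symbols `BEF`, `E_p`, `B_p`, `F`, `𝒩` appear only
inside quotation marks; the LEVELS `s ≤ k_L − j` (sibling modules); [J] §11.3 (proof of Lemma 11.2.8), whose displays carry the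
single rate `−2−3δ_dec` with no displayed arithmetic; [J] §11.7.4–11.7.7 (the collar, `TheoremM1M2Ledger` §2, §5); whether the
"standard mean value procedure" of [53] applies as invoked (the rule `descend` records only what the printed numbers do).
Every `theorem` is closed by `ring`, `linarith`, `norm_num`, `nlinarith` or `simp` on unfolded definitions; 0 `sorry`, standard axioms.

STATUS-RELATION.  Adds nothing to and changes nothing of modules `TheoremM1M2Ledger`, `FullRWInteriorLedger`,
`AbarDecayInteriorLedger`; uses three of their declarations by name (above).  The words "mean value", "interpolating",
"pigeonhole" are the texts' or folklore labels for steps whose analytic content is NOT asserted here.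
-/

namespace Literature.Geometry.Lorentzian.GiorgiKlainermanSzeftel2022.DecayRateLedger

open Literature.Geometry.Lorentzian.GiorgiKlainermanSzeftel2022.TheoremM1M2Ledger
open Literature.Geometry.Lorentzian.GiorgiKlainermanSzeftel2022.AbarDecayInteriorLedger

/-! ## §0 Two bookkeeping rules (our reading; [folklore]) -/

/-- The `r^p`-hierarchy descent rule obeyed by the printed exponents: a bound with rate `τ^{r}` at weight `p_high`, carried down
to weight `p_low ≤ p_high` by "the standard mean value procedure" ([J] p.530 L48–50, p.587 L98–99, citing [53] Thm 5.21/5.22),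
is printed with rate `τ^{r − (p_high − p_low)}`.  A ℚ-function recording the rule, not the analysis. [folklore] -/
def descend (r pHigh pLow : ℚ) : ℚ := r - (pHigh - pLow)

/-- Dyadic extraction: from `∫_{τ₁}^{τ₂} E(τ)dτ ≲ τ₁^{r}` "we infer the existence of a sequence of times `τ^{(j)} ∼ 2^j`" with
`E(τ^{(j)}) ≲ (τ^{(j)})^{r−1}` ([J] Step 8, p.591 L36–51).  A ℚ-function recording the gain of one power. [folklore] -/
def pigeonhole (r : ℚ) : ℚ := r - 1

/-- Unfolding lemma for `descend`. [folklore] -/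
@[simp] lemma descend_def (r pHigh pLow : ℚ) : descend r pHigh pLow = r - (pHigh - pLow) := rfl

/-- Unfolding lemma for `pigeonhole`. [folklore] -/
@[simp] lemma pigeonhole_def (r : ℚ) : pigeonhole r = r - 1 := rfl

/-- Descending in two legs equals descending once; descending by zero changes nothing. [folklore] -/
theorem descend_comp (r a b c : ℚ) : descend (descend r a b) b c = descend r a c ∧ descend r a a = r := by
  simp only [descend_def]; constructor <;> ring

/-! ## §1 [J] §11.7.3 = [v1] §11.7: the rates of Steps 1–9 of the proof of Theorem M1 on `τ ≤ τ_* − 2` -/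

/-- Step 1, (11.7.5): "`BEF_p[ψ, A](τ, τ_* − 2) ≲ ε₀²τ^{−(2−p−δ)}`" ([v1]: on `(τ, τ_*)`), for the range `δ ≤ p ≤ 2 − δ` of
Theorem 11.6.1.  The rate as a function of `p`.
[cite: GiorgiKlainermanSzeftel2024, Step 1 (11.7.5), p.530 L22–26; GiorgiKlainermanSzeftel2022, `eq:theoremM1-Chap11-3`, l.22398–22404] -/
def m1rS1 (p δ : ℚ) : ℚ := -(2 - p - δ)

/-- Unfolding lemma for `m1rS1`. [cite: GiorgiKlainermanSzeftel2024, (11.7.5), p.530 L22–26] -/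
@[simp] lemma m1rS1_def (p δ : ℚ) : m1rS1 p δ = -(2 - p - δ) := rfl

/-- (11.7.5) is the descent, from rate `0` at the top weight `p = 2 − δ`, down to `p`; at the top it is `0`, and at `p = δ` it is
the `−(2−2δ)` quoted in Step 4 ("In view of Step 1 we have `BEF_δ[ψ, A](τ, τ_*−2) ≲ ε₀²τ^{−(2−2δ)}`", [J] p.531 L26–27).
[cite: GiorgiKlainermanSzeftel2024, (11.7.5), p.530 L22–26, Step 4, p.531 L26–27; GiorgiKlainermanSzeftel2022, l.22403, l.22452] -/
theorem m1r_s1_descend (p δ : ℚ) :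
    m1rS1 p δ = descend 0 (2 - δ) p ∧ m1rS1 (2 - δ) δ = 0 ∧ m1rS1 δ δ = -(2 - 2 * δ) := by
  simp only [m1rS1_def, descend_def]; refine ⟨by ring, by ring, by ring⟩

/-- Step 2, first two displays: "`BEF_q[ψ̌] ≲ E_q[ψ̌](τ₁) + E_{max(q,δ)}^{s+1}[ψ, A](τ₁) + ε₀²τ₁^{q−3δ_dec}`" for
`−1+δ ≤ q ≤ 3δ_dec`, and "In view of Step 1, `E_{max(q,δ)}^{s+1}[ψ, A](τ₁) ≲ ε₀²τ₁^{−(2−max(q,δ)−δ)}` and hence …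
`BEF_q[ψ̌] ≲ E_q[ψ̌](τ₁) + ε₀²τ₁^{q−3δ_dec}`".  The absorption of the middle term, case `q ≥ δ` (`max = q`): it holds exactly
when `3δ_dec + δ ≤ 2`.
[cite: GiorgiKlainermanSzeftel2024, Step 2, p.530 L28–47; GiorgiKlainermanSzeftel2022, Step 2, l.22406–22421] -/
theorem m1r_s2_absorb_high (q δ δdec : ℚ) : (m1rS1 q δ ≤ q - 3 * δdec ↔ 3 * δdec + δ ≤ 2) := by
  simp only [m1rS1_def]; constructor <;> intro h <;> linarith

/-- Step 2, the same absorption in the case `q ≤ δ` (`max = δ`): `−(2−2δ) ≤ q − 3δ_dec` holds on the whole printed range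
`−1+δ ≤ q` as soon as `3δ_dec + δ ≤ 1`.
[cite: GiorgiKlainermanSzeftel2024, Step 2, p.530 L28–47; GiorgiKlainermanSzeftel2022, Step 2, l.22406–22421] -/
theorem m1r_s2_absorb_low (q δ δdec : ℚ) (hq : -1 + δ ≤ q) (hsmall : 3 * δdec + δ ≤ 1) : m1rS1 δ δ ≤ q - 3 * δdec := by
  simp only [m1rS1_def]; linarith

/-- Step 2, last display: "Applying the basic mean value theorem argument in the range `−1+3δ_dec ≤ q ≤ 3δ_dec` as in the proof
of Theorem 5.22 in [53] we deduce, for all `−1+3δ_dec ≤ q ≤ 3δ_dec`, `BEF_q[ψ̌] ≲ ε₀²τ₁^{−(3δ_dec − q)}`."  The printed rate is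
the descent from rate `0` at the top `q = 3δ_dec` (where the inhomogeneous term `τ₁^{q−3δ_dec}` has rate `0`), it coincides with
the inhomogeneous rate at `q`, and the printed range has length exactly `1`.
[cite: GiorgiKlainermanSzeftel2024, Step 2, p.530 L48–54; GiorgiKlainermanSzeftel2022, Step 2, l.22422–22426] -/
theorem m1r_s2_meanvalue (q δdec : ℚ) :
    descend 0 (3 * δdec) q = -(3 * δdec - q) ∧ q - 3 * δdec = -(3 * δdec - q) ∧ 3 * δdec - (-1 + 3 * δdec) = 1 := by
  simp only [descend_def]; refine ⟨by ring, by ring, by ring⟩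

/-- Step 3: "In view of Step 2, we have in particular, for `s ≤ k_L − 3` and `q = −δ`, `sup E_{−δ}[ψ̌] ≲ ε₀²τ₁^{−3δ_dec−δ}`
… `sup E_{2−δ}[ψ] ≲ ε₀²τ₁^{−3δ_dec−δ}`": the rate at `q = −δ`; `q = −δ` is the weight `p = 2 − δ` shifted by the two powers of
`r` in `ψ̌ = r²(…)ψ`; and `q = −δ` lies in Step 2's mean-value range `−1+3δ_dec ≤ q` exactly when `3δ_dec + δ ≤ 1` (the same
smallness as `m1r_s2_absorb_low`).
[cite: GiorgiKlainermanSzeftel2024, Step 3, p.531 L2–15; GiorgiKlainermanSzeftel2022, Step 3, l.22430–22438] -/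
theorem m1r_s3 (δ δdec : ℚ) :
    -(3 * δdec - (-δ)) = -3 * δdec - δ ∧ (2 - δ) - 2 = -δ ∧ (-1 + 3 * δdec ≤ -δ ↔ 3 * δdec + δ ≤ 1) := by
  refine ⟨by ring, by ring, ?_⟩; constructor <;> intro h <;> linarith

/-- Step 4, the inhomogeneous rate of Prop 11.2.1's estimate as quoted: "`BEF_p[ψ] ≲ E_p[ψ](τ₁) + BEF_δ[ψ, A](τ₁, τ₂) +
ε₀²τ₁^{p−2−3δ_dec}`", then written `ε₀²τ₁^{−(2+3δ_dec−p)}`.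
[cite: GiorgiKlainermanSzeftel2024, Step 4, p.531 L22–36; GiorgiKlainermanSzeftel2022, Step 4, l.22443–22456] -/
def m1rS4 (p δdec : ℚ) : ℚ := -(2 + 3 * δdec - p)

/-- Unfolding lemma for `m1rS4`. [cite: GiorgiKlainermanSzeftel2024, Step 4, p.531 L22–36] -/
@[simp] lemma m1rS4_def (p δdec : ℚ) : m1rS4 p δdec = -(2 + 3 * δdec - p) := rfl

/-- Step 4, the ORIGIN of the printed range: "Hence … `BEF_p[ψ] ≲ E_p[ψ](τ₁) + ε₀²τ₁^{−(2−2δ)} + ε₀²τ₁^{−(2+3δ_dec−p)}`.  In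
particular, … `BEF_p[ψ] ≲ E_p[ψ](τ₁) + ε₀²τ₁^{−(2+3δ_dec−p)}`, `3δ_dec + 2δ ≤ p ≤ 2 − δ`."  The two spellings of the
inhomogeneous rate agree, and Step 1's `ε₀²τ₁^{−(2−2δ)}` is dominated by `ε₀²τ₁^{−(2+3δ_dec−p)}` (for `τ₁ ≥ 1`) exactly when
`3δ_dec + 2δ ≤ p` — the printed lower end.
[cite: GiorgiKlainermanSzeftel2024, Step 4, p.531 L26–43; GiorgiKlainermanSzeftel2022, Step 4, l.22449–22461] -/
theorem m1r_s4_range (p δ δdec : ℚ) :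
    p - 2 - 3 * δdec = m1rS4 p δdec ∧ (m1rS1 δ δ ≤ m1rS4 p δdec ↔ 3 * δdec + 2 * δ ≤ p) := by
  simp only [m1rS4_def, m1rS1_def]; refine ⟨by ring, ?_⟩; constructor <;> intro h <;> linarith

/-- (11.7.6): "Together with Step 3 and the usual mean value argument, we deduce for `s ≤ k_L − 4`, `BEF_p[ψ] ≲
ε₀²τ₁^{−(2+3δ_dec−p)}`, `1−δ ≤ p ≤ 2−δ`."  The printed rate is EXACTLY the descent of Step 3's rate `−3δ_dec−δ` from the top
weight `2−δ` down to `p`, and coincides with the inhomogeneous rate `m1rS4 p` at every `p` (so neither term limits the other);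
the printed range `1−δ ≤ p` lies inside the previous display's `3δ_dec + 2δ ≤ p` exactly when `3δ_dec + 3δ ≤ 1`.
[cite: GiorgiKlainermanSzeftel2024, (11.7.6), p.531 L45–56; GiorgiKlainermanSzeftel2022, `eq:Flux-psiStep4:beforetolast`, l.22462–22467] -/
theorem m1r_1176 (p δ δdec : ℚ) :
    descend (-3 * δdec - δ) (2 - δ) p = m1rS4 p δdec ∧ (3 * δdec + 2 * δ ≤ 1 - δ ↔ 3 * δdec + 3 * δ ≤ 1) := by
  simp only [descend_def, m1rS4_def]; refine ⟨by ring, ?_⟩; constructor <;> intro h <;> linarith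

/-- (11.7.7): "In particular, for `s ≤ k_L − 4`, we have `BEF_{1−δ}[ψ] ≲ ε₀²τ₁^{−(3δ_dec+1+δ)}`" — (11.7.6) at `p = 1 − δ`;
and at `p = 1 + δ` (used by Step 5) the rate is `−(1+3δ_dec−δ)`.
[cite: GiorgiKlainermanSzeftel2024, (11.7.7), p.531 L58–65; GiorgiKlainermanSzeftel2022, `eq:Flux-psiStep4`, l.22468–22473] -/
theorem m1r_1177 (δ δdec : ℚ) :
    m1rS4 (1 - δ) δdec = -(3 * δdec + 1 + δ) ∧ m1rS4 (1 + δ) δdec = -(1 + 3 * δdec - δ) := by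
  simp only [m1rS4_def]; constructor <;> ring

/-- Step 5, (11.7.8): "As in Proposition 5.12 in [53], we interpolate the control on `E_p[ψ]` provided (11.7.6) between
`p = 1+δ` and `p = 1−δ` and obtain `τ^{1+3δ_dec}∫_{S_r}|𝔡^{≤s}ψ|² ≲ ε₀²` … `|𝔡^{≤s}ψ| ≲ ε₀r^{−1}τ^{−(1+3δ_dec)/2}`."
The weight `p = 1` is the midpoint of `1 ± δ`, the midpoint of the two rates is EXACTLY `−(1+3δ_dec)`, and the pointwise bound
carries half of it (with the `r^{−1}` of `|ψ|² ≲ r^{−2}∫_{S_r}|𝔡^{≤2}ψ|²`: `(0 − 2)/2 = −1`).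
[cite: GiorgiKlainermanSzeftel2024, Step 5 (11.7.8), p.531 L67–p.532 L13; GiorgiKlainermanSzeftel2022, Step 5, l.22476–22483] -/
theorem m1r_s5_interp (δ δdec : ℚ) :
    ((1 + δ) + (1 - δ)) / 2 = 1 ∧ (m1rS4 (1 + δ) δdec + m1rS4 (1 - δ) δdec) / 2 = -(1 + 3 * δdec) ∧
    -(1 + 3 * δdec) / 2 = -((1 + 3 * δdec) / 2) ∧ ((0 : ℚ) - 2) / 2 = -1 := by
  simp only [m1rS4_def]; refine ⟨by ring, by ring, by ring, by norm_num⟩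

/-- Step 6, (11.7.10)–(11.7.11): "`|𝔡^{≤s}A| ≲ ε₀r^{−3}τ^{−(1+3δ_dec)/2}`" (two powers of `r` below (11.7.8)'s `r^{−1}`, via
the transport system (11.7.9)) and "`E_{1−δ}[A](τ) ≲ ε₀²τ^{−(1+3δ_dec)}`" (the square of the pointwise rate).
[cite: GiorgiKlainermanSzeftel2024, Step 6 (11.7.9)–(11.7.11), p.532 L15–58; GiorgiKlainermanSzeftel2022, Step 6, l.22485–22504] -/
theorem m1r_s6 (δdec : ℚ) : (-1 : ℚ) + (-2) = -3 ∧ 2 * (-((1 + 3 * δdec) / 2)) = -(1 + 3 * δdec) := by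
  constructor <;> ring

/-- Step 7, first two displays: "The estimates (11.7.7) and (11.7.11) imply … `E_{1−δ}[A, ψ](τ) ≲ ε₀²τ^{−(1+3δ_dec)}`" — the
`ψ`-part (11.7.7) has the better rate `−(3δ_dec+1+δ)` iff `0 ≤ δ` — and the [J]-only display "Using Theorem 11.6.1, …
`BEF_{1−δ}[A, ψ](τ, τ_*−2) ≲ E_{1−δ}[ψ, A](τ) + ε₀²τ^{1−δ−2−3δ_dec} ≲ ε₀²τ^{−(1+3δ_dec)}`" ([v1] l.22507–22512 has only the
first): the inhomogeneous rate at `p = 1−δ` is `m1rS4 (1−δ)` and is dominated iff `0 ≤ δ`.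
[cite: GiorgiKlainermanSzeftel2024, Step 7, p.532 L60–70; GiorgiKlainermanSzeftel2022, Step 7, l.22507–22510] -/
theorem m1r_s7_inputs (δ δdec : ℚ) :
    (m1rS4 (1 - δ) δdec ≤ -(1 + 3 * δdec) ↔ 0 ≤ δ) ∧ (1 - δ - 2 - 3 * δdec = m1rS4 (1 - δ) δdec) := by
  simp only [m1rS4_def]; refine ⟨?_, by ring⟩; constructor <;> intro h <;> linarith

/-- Step 7, (11.7.12): "We can thus run again the standard mean value argument and deduce from that estimate and Theorem
11.6.1, for `s ≤ k_L − 7`, `BEF_δ[A, ψ](τ, τ_*−2) ≲ ε₀²τ^{−(2+3δ_dec−2δ)}`.  In particular, … `BEF_δ[ψ](τ, τ_*−2) ≲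
ε₀²τ^{−(2+3δ_dec−2δ)}` (11.7.12)."  The printed rate is EXACTLY the descent of `−(1+3δ_dec)` from weight `1−δ` to weight `δ`,
and the inhomogeneous rate at `p = δ`, `m1rS4 δ = δ−2−3δ_dec`, is at least as good iff `0 ≤ δ`.
[cite: GiorgiKlainermanSzeftel2024, Step 7 (11.7.12), p.532 L72–78; GiorgiKlainermanSzeftel2022, Step 7, l.22511–22519] -/
theorem m1r_1712 (δ δdec : ℚ) :
    descend (-(1 + 3 * δdec)) (1 - δ) δ = -(2 + 3 * δdec - 2 * δ) ∧ (m1rS4 δ δdec ≤ -(2 + 3 * δdec - 2 * δ) ↔ 0 ≤ δ) := by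
  simp only [descend_def, m1rS4_def]; refine ⟨by ring, ?_⟩; constructor <;> intro h <;> linarith

/-- (D1, both texts) Step 7, the next display: "in view of the definition of the flux norms `F^s_δ[ψ]` in Section 6.1.5, we deduce,
on `Σ_*`, `∫_{Σ_*(τ,τ_*−2)}|∇₃𝔡^{s−1}ψ|² ≲ ε₀²τ^{−(2+3δ_dec−3δ)}`" ([v1] l.22522: on `Σ_*(≥τ)`, same exponent).  As printed,
with `3δ`, the displayed rate is WEAKER than (11.7.12)'s `−(2+3δ_dec−2δ)` (hence a true consequence of it) iff `0 ≤ δ`.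
[cite: GiorgiKlainermanSzeftel2024, Step 7, p.532 L80–83; GiorgiKlainermanSzeftel2022, Step 7, l.22520–22522] -/
theorem m1r_D1_display (δ δdec : ℚ) : (-(2 + 3 * δdec - 2 * δ) ≤ -(2 + 3 * δdec - 3 * δ) ↔ 0 ≤ δ) := by
  constructor <;> intro h <;> linarith

/-- (D1) Step 7, the conclusion: "Hence, choosing `δ_extra = (3δ_dec−2δ)/2 > δ_dec`, for `s ≤ k_L − 7`,
`∫_{Σ_*(τ,τ_*−2)}|∇₃𝔡^{s−1}ψ|² ≲ ε₀²τ^{−2−2δ_extra}` which establishes the desired estimate (11.7.2) for `τ ≤ τ_* − 2`."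
With the printed `δ_extra` (`TheoremM1M2Ledger.dextraA`), `−2−2δ_extra` is EXACTLY (11.7.12)'s `−(2+3δ_dec−2δ)`; so the
conclusion follows from (11.7.12) and the printed definitions of the norms (§6.1.5 item 3: `F_{Σ_*}[ψ] ∋ ∫_{Σ_*}|∇₃ψ|²`; items 7,
8, 11: `F ≤ F_p ≤ BEF_p`, summed over `𝔡^k`, `k ≤ s`), whereas from the preceding display AS PRINTED (`3δ`) it would follow only
if `δ ≤ 0` — the display's `3δ` reads as a misprint for `2δ`, with no effect on (11.7.2).
[cite: GiorgiKlainermanSzeftel2024, Step 7, p.533 L2–9, §6.1.5 items 3, 7, 8, 11, p.219 L2–8, L122–132, p.220 L5–8, L32–37; GiorgiKlainermanSzeftel2022, Step 7, l.22524–22528, `subsection:basicnormsforpsi`, l.9916–9996] -/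
theorem m1r_D1_hence_iff (δ δdec : ℚ) :
    -2 - 2 * dextraA δdec δ = -(2 + 3 * δdec - 2 * δ) ∧ (-(2 + 3 * δdec - 3 * δ) ≤ -2 - 2 * dextraA δdec δ ↔ δ ≤ 0) := by
  simp only [dextraA_def]; refine ⟨by ring, ?_⟩; constructor <;> intro h <;> linarith

/-- Step 8, (11.7.13)–(11.7.14): "`r^{−1}∫_{S_r}|𝔡^{≤s}ψ|² ≲ ε₀²τ^{−(2+3δ_dec−2δ)}`", "`∫_{S_r}|𝔡^{≤s−1}∇₃ψ|² ≲
ε₀²τ^{−(2+3δ_dec−2δ)}`" — (11.7.12)'s rate, i.e. `−2−2δ_extra`; pointwise (with `|ψ|² ≲ r^{−2}∫_{S_r}|𝔡^{≤2}ψ|²`) this is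
`|𝔡ψ| ≲ ε₀r^{−1/2}τ^{−1−δ_extra}` and `|∇₃𝔡ψ| ≲ ε₀r^{−1}τ^{−1−δ_extra}`: half-rates and `r`-exponents `(1−2)/2`, `(0−2)/2`.
[cite: GiorgiKlainermanSzeftel2024, Step 8 (11.7.13)–(11.7.14), p.533 L10–25; GiorgiKlainermanSzeftel2022, Step 8, l.22529–22541] -/
theorem m1r_s8 (δ δdec : ℚ) :
    -(2 + 3 * δdec - 2 * δ) / 2 = -1 - dextraA δdec δ ∧ ((1 : ℚ) - 2) / 2 = -1 / 2 ∧ ((0 : ℚ) - 2) / 2 = -1 := by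
  simp only [dextraA_def]; refine ⟨by ring, by norm_num, by norm_num⟩

/-- Step 9, (11.7.15): "In view of (11.7.8), (11.7.13) and (11.7.14), and since `ψ = ℜ(𝔮)`, …
`sup_{M(τ≤τ_*−2)}(rτ^{1/2+δ_extra} + τ^{1+δ_extra})|𝔡^{≤s}𝔮| + sup rτ^{1+δ_extra}|𝔡^{≤s−1}∇₃𝔮| ≲ ε₀` for
`δ_extra = (3δ_dec−2δ)/2 > δ_dec`."  The three products of weights and rates: `rτ^{1/2+δ_extra} × r^{−1}τ^{−(1+3δ_dec)/2}`
(from (11.7.8)) has `τ`-exponent EXACTLY `−δ ≤ 0` and `r`-exponent `0`; `τ^{1+δ_extra} × r^{−1/2}τ^{−1−δ_extra}` (from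
(11.7.13)) and `rτ^{1+δ_extra} × r^{−1}τ^{−1−δ_extra}` (from (11.7.14)) have `τ`-exponent `0` and `r`-exponents `−1/2`, `0`.
[cite: GiorgiKlainermanSzeftel2024, Step 9 (11.7.15), p.533 L27–37; GiorgiKlainermanSzeftel2022, Step 9 `eq:theoremM1-Chap11-psi`, l.22543–22550] -/
theorem m1r_s9 (δ δdec : ℚ) :
    (1 / 2 + dextraA δdec δ) + (-((1 + 3 * δdec) / 2)) = -δ ∧ (1 : ℚ) + (-1) = 0 ∧
    (1 + dextraA δdec δ) + (-1 - dextraA δdec δ) = 0 ∧ (0 : ℚ) + (-1 / 2) = -1 / 2 ∧ (1 : ℚ) + (-1) = 0 := by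
  simp only [dextraA_def]; refine ⟨by ring, by norm_num, by ring, by norm_num, by norm_num⟩

/-- Step 9's first product decays (`τ^{−δ} ≤ 1` for `τ ≥ 1`) iff `0 ≤ δ`, and is NOT wasted (exponent exactly `0`) iff `δ = 0`:
the printed `δ_extra` is the largest value compatible with (11.7.8) up to the loss `δ`.  Arithmetic only.
[cite: GiorgiKlainermanSzeftel2024, Step 9 (11.7.15), p.533 L27–37; GiorgiKlainermanSzeftel2022, l.22543–22550] -/
theorem m1r_s9_slack (δ δdec e : ℚ) :
    ((1 / 2 + e) + (-((1 + 3 * δdec) / 2)) ≤ 0 ↔ e ≤ 3 * δdec / 2) ∧ (dextraA δdec δ ≤ 3 * δdec / 2 ↔ 0 ≤ δ) ∧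
    (dextraA δdec δ = 3 * δdec / 2 ↔ δ = 0) := by
  simp only [dextraA_def]
  refine ⟨?_, ?_, ?_⟩
  · constructor <;> intro h <;> linarith
  · constructor <;> intro h <;> linarith
  · constructor <;> intro h <;> linarith

/-! ## §2 [J] §12.4.2: the exponents displayed in the proof of Lemma 12.4.8 (= Lemma 12.2.6) at `s = 0` -/

/-- The two interpolation endpoints for `|𝔡^{≤2}(A, B)|²`: "interpolating between (12.1.1) and (12.1.2) to control `(A, B)`" with
the displayed factors `(1/(r⁶τ^{1+2δ_dec}))^{1−θ}` and `(1/r^{7+2δ_dec})^{θ}`.  They are the SQUARES of the rates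
`r^{−3}τ^{−(1/2+δ_dec)}` ((12.1.1) read on `(A,B) ∈ r^{−1}Γ_g`: `r²τ^{1/2+δ_dec}|Γ_g| ≤ ε`) and `r^{−(7/2+δ_dec)}` ((12.1.2):
`r^{7/2+δ_dec}|𝔡^{≤k}(A,B)| ≤ ε`).
[cite: GiorgiKlainermanSzeftel2024, proof of Lemma 12.4.8, p.587 L5–38, (12.1.1)–(12.1.2), p.544 L14–31; GiorgiKlainermanSzeftel2022, l.24353–24356, l.22598–22607] -/
theorem nerr_endpoints (δdec : ℚ) :
    2 * (-3 : ℚ) = -6 ∧ 2 * (-(1 / 2 + δdec)) = -(1 + 2 * δdec) ∧ 2 * (-(7 / 2 + δdec)) = -(7 + 2 * δdec) := by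
  refine ⟨by norm_num, by ring, by ring⟩

/-- "Also, we have, for `δ ≤ p ≤ 1−δ`, `∫_𝓜 r^{p+1}|N|² ≲ ε²∫_𝓜 (r^{p+3}/τ^{2+2δ_dec})|𝔡^{≤2}(A,B)|² ≲ (ε²/τ₁^{1+2δ_dec})∫_𝓜
(r^{p+3}/τ)|𝔡^{≤2}(A,B)|²`": with `Ñ_err = r²𝔡^{≤2}(Γ_b·(A,B))` ((12.1.9)) and `rτ^{1+δ_dec}|Γ_b| ≤ ε` ((12.1.1)), the
`r`-exponent is `(p+1) + 2·2 − 2 = p+3`, the `τ`-exponent is `−2(1+δ_dec) = −(2+2δ_dec)`, split as `−(1+2δ_dec) + (−1)`.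
[cite: GiorgiKlainermanSzeftel2024, proof of Lemma 12.4.8, p.586 L77–101, (12.1.9), p.545; GiorgiKlainermanSzeftel2022, l.24348–24352] -/
theorem nerr_weights (p δdec : ℚ) :
    (p + 1) + 2 * 2 - 2 = p + 3 ∧ -(2 * (1 + δdec)) = -(2 + 2 * δdec) ∧ -(2 + 2 * δdec) = -(1 + 2 * δdec) + (-1) := by
  refine ⟨by ring, by ring, by ring⟩

/-- The interpolation parameter: the displayed exponents are `1 − (p+δ)/(1+2δ_dec)` and `(p+δ)/(1+2δ_dec)`, i.e. `θ` with
`θ(1+2δ_dec) = p+δ`.  On the printed range `δ ≤ p ≤ 1−δ` (and `0 ≤ δ_dec`), `0 ≤ p+δ ≤ 1+2δ_dec`, so `0 ≤ θ ≤ 1` whenever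
`0 < 1+2δ_dec`.
[cite: GiorgiKlainermanSzeftel2024, proof of Lemma 12.4.8, p.587 L5–38; GiorgiKlainermanSzeftel2022, l.24353–24356] -/
theorem nerr_theta_range (p δ δdec θ : ℚ) (hθ : θ * (1 + 2 * δdec) = p + δ) (hpos : 0 < 1 + 2 * δdec)
    (hδ : 0 ≤ δ) (hp : δ ≤ p) (hp' : p ≤ 1 - δ) (hdec : 0 ≤ δdec) : 0 ≤ θ ∧ θ ≤ 1 := by
  constructor
  · rcases le_or_gt 0 θ with h | h
    · exact h
    · have : θ * (1 + 2 * δdec) < 0 := mul_neg_of_neg_of_pos h hpos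
      linarith
  · rcases le_or_gt θ 1 with h | h
    · exact h
    · have : 1 * (1 + 2 * δdec) < θ * (1 + 2 * δdec) := mul_lt_mul_of_pos_right h hpos
      linarith

/-- The displayed result of the interpolation: "`≲ (ε⁴/τ₁^{1+2δ_dec})(∫ dr/r^{1+δ})(∫_{τ≥τ₁} dτ/τ^{2+2δ_dec−(p+δ)})`".  With
`θ(1+2δ_dec) = p+δ`: the `r`-exponent `(p+3) − 6(1−θ) − (7+2δ_dec)θ`, together with the `r²` of the volume element of `𝓜`
(coarea over the spheres `S_r`; the measure is not displayed), is EXACTLY `−1−δ`; the `τ`-exponent `−1 − (1+2δ_dec)(1−θ)` is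
EXACTLY `−(2+2δ_dec−(p+δ))`.
[cite: GiorgiKlainermanSzeftel2024, proof of Lemma 12.4.8, p.587 L5–57; GiorgiKlainermanSzeftel2022, l.24353–24357] -/
theorem nerr_interp_exponents (p δ δdec θ : ℚ) (hθ : θ * (1 + 2 * δdec) = p + δ) :
    (p + 3) - 6 * (1 - θ) - (7 + 2 * δdec) * θ + 2 = -1 - δ ∧ -1 - (1 + 2 * δdec) * (1 - θ) = -(2 + 2 * δdec - (p + δ)) := by
  constructor
  · linear_combination (-1 : ℚ) * hθ
  · linear_combination hθ

/-- Without the `r²` of the volume element the same `r`-exponent would be `−3−δ` (still integrable at infinity); recorded so that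
the reading "`∫ dr/r^{1+δ}`" = integrand × `r²dr` is explicit.  Arithmetic only.
[cite: GiorgiKlainermanSzeftel2024, proof of Lemma 12.4.8, p.587 L43–57; GiorgiKlainermanSzeftel2022, l.24357] -/
theorem nerr_interp_r_bare (p δ δdec θ : ℚ) (hθ : θ * (1 + 2 * δdec) = p + δ) :
    (p + 3) - 6 * (1 - θ) - (7 + 2 * δdec) * θ = -3 - δ := by
  linear_combination (-1 : ℚ) * hθ

/-- The `τ`-integral converges at infinity iff `2+2δ_dec−(p+δ) > 1`, i.e. `p+δ < 1+2δ_dec`, which holds on the printed range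
`p ≤ 1−δ` as soon as `0 < δ_dec`; it then contributes `τ₁^{1−(2+2δ_dec−(p+δ))} = τ₁^{−1−2δ_dec+(p+δ)}`, and the `r`-integral
`∫^∞ dr/r^{1+δ}` converges iff `0 < δ`.
[cite: GiorgiKlainermanSzeftel2024, proof of Lemma 12.4.8, p.587 L43–57; GiorgiKlainermanSzeftel2022, l.24357] -/
theorem nerr_integrability (p δ δdec : ℚ) :
    (1 < 2 + 2 * δdec - (p + δ) ↔ p + δ < 1 + 2 * δdec) ∧ (p ≤ 1 - δ → 0 < δdec → p + δ < 1 + 2 * δdec) ∧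
    1 - (2 + 2 * δdec - (p + δ)) = -1 - 2 * δdec + (p + δ) ∧ (1 < 1 + δ ↔ 0 < δ) := by
  refine ⟨?_, ?_, by ring, ?_⟩
  · constructor <;> intro h <;> linarith
  · intro h1 h2; linarith
  · constructor <;> intro h <;> linarith

/-- "and hence, for `δ ≤ p ≤ 1−δ`, `∫_𝓜 r^{p+1}|N|² ≲ ε₀²τ₁^{−2−3δ_dec+(p+δ)}`" ([J]).  The product of the prefactor
`τ₁^{−(1+2δ_dec)}` and the `τ`-integral is `τ₁^{−2−4δ_dec+(p+δ)}`; the PRINTED exponent `−2−3δ_dec+(p+δ)` is weaker by exactly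
`δ_dec` (a true consequence iff `0 ≤ δ_dec`), and it is twice Lemma 12.4.8's `−1−(3/2)δ_dec+(p+δ)/2`
(`AbarDecayInteriorLedger.cor1225_exponent`).
[cite: GiorgiKlainermanSzeftel2024, proof of Lemma 12.4.8, p.587 L59–66, Lemma 12.4.8 (12.4.9), p.586 L33–44; GiorgiKlainermanSzeftel2022, l.24358–24361, l.24332–24336] -/
theorem nerr_total (p δ δdec : ℚ) :
    -(1 + 2 * δdec) + (-1 - 2 * δdec + (p + δ)) = -2 - 4 * δdec + (p + δ) ∧
    (-2 - 4 * δdec + (p + δ) ≤ -2 - 3 * δdec + (p + δ) ↔ 0 ≤ δdec) ∧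
    (-2 - 3 * δdec + (p + δ)) - (-2 - 4 * δdec + (p + δ)) = δdec ∧
    2 * (-1 - 3 / 2 * δdec + (p + δ) / 2) = -2 - 3 * δdec + p + δ := by
  refine ⟨by ring, ?_, by ring, cor1225_exponent δdec p δ⟩
  constructor <;> intro h <;> linarith

/-- (D2, [v1]→[J]) [v1] l.24360 prints the same line as "`≲ ε₀²τ₁^{−2−3δ_dec−(p+δ)}`" (MINUS `(p+δ)`), between its own
`∫_{τ≥τ₁}dτ/τ^{2+2δ_dec−(p+δ)}` (l.24357) and its conclusion `ε₀τ₁^{−1−(3/2)δ_dec+(p+δ)/2}` (l.24366), both of which carry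
`+(p+δ)`; [J] p.587 L59–66 prints `+(p+δ)`.  As arithmetic: the available `−2−4δ_dec+(p+δ)` implies the [v1] exponent only when
`2(p+δ) ≤ δ_dec`, which fails at the top of the range `p = 1−δ` as soon as `δ_dec < 2`; and the [v1] exponent is NOT twice the
lemma's unless `p+δ = 0`.
[cite: GiorgiKlainermanSzeftel2022, l.24355–24366; GiorgiKlainermanSzeftel2024, proof of Lemma 12.4.8, p.587 L43–84] -/
theorem nerr_v1_sign (p δ δdec : ℚ) :
    (-2 - 4 * δdec + (p + δ) ≤ -2 - 3 * δdec - (p + δ) ↔ 2 * (p + δ) ≤ δdec) ∧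
    (p = 1 - δ → δdec < 2 → ¬ (-2 - 4 * δdec + (p + δ) ≤ -2 - 3 * δdec - (p + δ))) ∧
    (2 * (-1 - 3 / 2 * δdec + (p + δ) / 2) = -2 - 3 * δdec - (p + δ) ↔ p + δ = 0) := by
  refine ⟨?_, ?_, ?_⟩
  · constructor <;> intro h <;> linarith
  · intro hp hdec h; subst hp; linarith
  · constructor <;> intro h <;> linarith

/-- The trapped-region term, [J]: "Recalling that `Ñ_err = r²𝔡^{≤2}(Γ_b·(A,B))`, see (12.1.9), we immediately have, using
(12.1.1), `∫_{τ₁}^{τ₂}‖N‖_{L²(Σ_trap(τ))} ≲ ε²τ₁^{−1−2δ_dec} ≲ ε₀τ₁^{−1−2δ_dec}`."  With both factors at the (12.1.1) rate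
`τ^{−1−δ_dec}` on bounded `r`: the product has rate `−2−2δ_dec` and its `dτ`-integral from `τ₁` has rate `−1−2δ_dec`; the
conversion `ε² ≲ ε₀` is `AbarDecayInteriorLedger.eps_convention` (`ε = ε₀^{2/3}`).
[cite: GiorgiKlainermanSzeftel2024, proof of Lemma 12.4.8, p.586 L63–75, (12.1.1), p.544 L14–27; GiorgiKlainermanSzeftel2022, l.22598–22602] -/
theorem nerr_trap_J (δdec : ℚ) :
    (-1 - δdec) + (-1 - δdec) = -2 - 2 * δdec ∧ (-2 - 2 * δdec) + 1 = -1 - 2 * δdec := by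
  constructor <;> ring

/-- (D3, [v1]→[J]) [v1] l.24346 prints the trapped term as "`≲ ε⁴τ₁^{−2−3δ_dec} ≲ ε₀²τ₁^{−2−3δ_dec}`" and does not take its
square root in the final display (l.24341–24344: `𝒩_p ≲ BEF_p^{1/2}(∫‖N‖_{L²(Σ_trap)} + (∫r^{p+1}|N|²)^{1/2})`); [J] prints
`ε²τ₁^{−1−2δ_dec} ≲ ε₀τ₁^{−1−2δ_dec}`.  Either printed trapped rate is dominated by the far-region half-rate
`−1−(3/2)δ_dec+(p+δ)/2` in the final maximum when `0 ≤ δ_dec` and `0 ≤ p+δ`, so the conclusion (12.4.9) is unaffected.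
[cite: GiorgiKlainermanSzeftel2022, l.24341–24347; GiorgiKlainermanSzeftel2024, proof of Lemma 12.4.8, p.586 L46–75] -/
theorem nerr_v1_trap (p δ δdec : ℚ) (hdec : 0 ≤ δdec) (hpd : 0 ≤ p + δ) :
    -1 - 2 * δdec ≤ -1 - 3 / 2 * δdec + (p + δ) / 2 ∧ -2 - 3 * δdec ≤ -1 - 3 / 2 * δdec + (p + δ) / 2 := by
  constructor <;> linarith

/-- "In view of the above, we deduce, for `δ ≤ p ≤ 1−δ`, `𝒩_p[ψ̲, Ñ_err](τ₁, τ₂) ≲ ε₀τ₁^{−1−(3/2)δ_dec+(p+δ)/2}(BEF_p[ψ̲](τ₁,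
τ₂))^{1/2}`, which proves (12.4.9) in the particular case `s = 0`."  The far-region half-rate is half of the printed
`−2−3δ_dec+(p+δ)`, it dominates [J]'s trapped rate `−1−2δ_dec` (`nerr_v1_trap`), and `ε⁴ ≲ ε₀²` under the square root is the
other clause of `AbarDecayInteriorLedger.eps_convention`.
[cite: GiorgiKlainermanSzeftel2024, proof of Lemma 12.4.8, p.587 L68–89; GiorgiKlainermanSzeftel2022, l.24362–24368] -/
theorem nerr_final (p δ δdec : ℚ) (hdec : 0 ≤ δdec) (hpd : 0 ≤ p + δ) :
    (-2 - 3 * δdec + (p + δ)) / 2 = -1 - 3 / 2 * δdec + (p + δ) / 2 ∧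
    max (-1 - 2 * δdec) (-1 - 3 / 2 * δdec + (p + δ) / 2) = -1 - 3 / 2 * δdec + (p + δ) / 2 := by
  refine ⟨by ring, max_eq_right (by linarith)⟩

/-- The available (unprinted) sharper total `−2−4δ_dec+(p+δ)` would give the half-rate `−1−2δ_dec+(p+δ)/2`, better than the
printed one by `δ_dec/2`; the text keeps `3δ_dec`, which is what Cor 12.2.5 / (12.4.10) consume.  Arithmetic only.
[cite: GiorgiKlainermanSzeftel2024, proof of Lemma 12.4.8, p.587 L43–89, (12.4.10), p.587 L90–96] -/
theorem nerr_slack (p δ δdec : ℚ) :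
    (-2 - 4 * δdec + (p + δ)) / 2 = -1 - 2 * δdec + (p + δ) / 2 ∧
    (-1 - 3 / 2 * δdec + (p + δ) / 2) - (-1 - 2 * δdec + (p + δ) / 2) = δdec / 2 := by
  constructor <;> ring

/-! ## §3 [J] Prop 12.4.6, Steps 1–8: the rates -/

/-- Step 1, (12.4.10): "`BEF_p[ψ̲, A̲](τ₁, τ₂) ≲ E_p[ψ̲, A̲](τ₁) + ε₀²τ₁^{−2−3δ_dec+p+δ}`, `δ ≤ p ≤ 1−δ`" (Cor 12.2.5).  The
inhomogeneous rate as a function of `p`.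
[cite: GiorgiKlainermanSzeftel2024, Step 1 (12.4.10), p.587 L90–97; GiorgiKlainermanSzeftel2022, `eq:step1fluxSigamstarLiebTAbchap12:1`, l.24374–24380] -/
def m2rInhom (p δ δdec : ℚ) : ℚ := -2 - 3 * δdec + p + δ

/-- Unfolding lemma for `m2rInhom`. [cite: GiorgiKlainermanSzeftel2024, (12.4.10), p.587 L90–97] -/
@[simp] lemma m2rInhom_def (p δ δdec : ℚ) : m2rInhom p δ δdec = -2 - 3 * δdec + p + δ := rfl

/-- (12.4.10)'s rate at the two ends of its range and at `p = δ`: `−1−3δ_dec` at `p = 1−δ`, `−2−3δ_dec+2δ` at `p = δ` (the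
second exponent of Step 7 item 4).
[cite: GiorgiKlainermanSzeftel2024, (12.4.10), p.587 L90–97, Step 7 item 4, p.590 L73–76; GiorgiKlainermanSzeftel2022, l.24374–24380, l.24514] -/
theorem m2r_inhom_ends (δ δdec : ℚ) :
    m2rInhom (1 - δ) δ δdec = -1 - 3 * δdec ∧ m2rInhom δ δ δdec = -2 - 3 * δdec + 2 * δ := by
  simp only [m2rInhom_def]; constructor <;> ring

/-- Step 2, (12.4.11): "applying the standard mean value procedure, see for instance the statement and proof of Theorem 5.21 in
[53], we infer from (12.4.10), for `s ≤ k_L − 1`, `BEF_δ[ψ̲, A̲](τ₁, τ_*−2) ≲ ε₀²τ₁^{−1+2δ}`" ([v1]: on `(τ₁, τ_*)`).  The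
printed rate is EXACTLY the descent of rate `0` (bounded energy at `τ₁`) from the top weight `1−δ` of (12.4.10) to `δ`, and the
inhomogeneous rate at `p = δ` is better iff `−1 ≤ 3δ_dec`.
[cite: GiorgiKlainermanSzeftel2024, Step 2 (12.4.11), p.587 L98–100; GiorgiKlainermanSzeftel2022, `eq:step1fluxSigamstarLiebTAbchap12:2`, l.24383–24387] -/
theorem m2r_12411 (δ δdec : ℚ) :
    descend 0 (1 - δ) δ = -1 + 2 * δ ∧ (m2rInhom δ δ δdec ≤ -1 + 2 * δ ↔ -1 ≤ 3 * δdec) := by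
  simp only [descend_def, m2rInhom_def]; refine ⟨by ring, ?_⟩; constructor <;> intro h <;> linarith

/-- Step 3, (12.4.12): "`∫_𝓜 r^{−1−δ}|𝓛̸_T𝔡^{≤s}𝔮̲|² ≲ ∫_𝓜 (r^{−1−δ}|∇₃𝔡^{≤s}𝔮̲|² + r^{−3−δ}|𝔡^{≤s+1}𝔮̲|²) ≲ B^{s+1}_δ[ψ̲]` …
`≲ ε₀²τ₁^{−1+2δ}` … `B_p[𝓛̸_Tψ̲](τ₁, τ_*−2) ≲ ε₀²τ₁^{−1+2δ}` for all `δ ≤ p ≤ 2−δ`": the rate `−1+2δ` of (12.4.11) is carried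
unchanged to every `p` (one `T`-derivative traded, a LEVEL datum of the siblings); the two `r`-weights differ by `2`.
[cite: GiorgiKlainermanSzeftel2024, Step 3 (12.4.12), p.587 L101–p.588 L17; GiorgiKlainermanSzeftel2022, Step 3, l.24390–24402] -/
theorem m2r_12412 (δ : ℚ) : (-1 - δ) - 2 = -3 - δ ∧ descend (-1 + 2 * δ) δ δ = -1 + 2 * δ := by
  simp only [descend_def]; constructor <;> ring

/-- Step 4, (12.4.13)–(12.4.14), and Step 5's first display: "`B_p[𝓛̸_TA̲] ≲ B_δ[𝓛̸_Tψ̲] + E_p[𝓛̸_TA̲](τ₁) + ε₀²τ₁^{−2−2δ_dec}`"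
(12.4.14), "we deduce from (12.4.12) and (12.4.14) … `B_p[𝓛̸_TA̲](τ₁, τ₂) ≲ E_p[𝓛̸_TA̲](τ₁) + ε₀²τ₁^{−1+2δ}`": the nonlinear
rate `−2−2δ_dec` is absorbed by (12.4.12)'s `−1+2δ` iff `−1 ≤ 2δ_dec + 2δ`.
[cite: GiorgiKlainermanSzeftel2024, (12.4.14), p.589 L5–11, Step 5, p.589 L13–17; GiorgiKlainermanSzeftel2022, `eq:transportAb:Liebversion`, l.24433–24442] -/
theorem m2r_s5_absorb (δ δdec : ℚ) : (-2 - 2 * δdec ≤ -1 + 2 * δ ↔ -1 ≤ 2 * δdec + 2 * δ) := by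
  constructor <;> intro h <;> linarith

/-- Step 5, the ORIGIN of the two printed `p`-ranges: "`∫_{τ₁}^{τ₂}E_p[𝓛̸_TA̲] ≲ B_{p−1}[𝓛̸_TA̲]`" hence "`∫E_{1+δ}[𝓛̸_TA̲] ≲
B_δ[𝓛̸_TA̲]`" and "for all `δ ≤ p ≤ 1+δ`, `∫E_p[𝓛̸_TA̲] ≲ ε₀²τ₁^{−1+2δ}`" (top: `p − 1 = δ`); "`∫_{τ₁}^{τ₂}E_p[𝓛̸_Tψ̲] ≲
B_{p+1}[𝓛̸_Tψ̲]`" hence "in view of (12.4.12), for `s ≤ k_L − 4` and for all `δ ≤ p ≤ 1−δ`, `∫E_p[𝓛̸_Tψ̲, 𝓛̸_TA̲] ≲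
ε₀²τ₁^{−1+2δ}`" (top: `p + 1 = 2 − δ`, the top of (12.4.12)'s range); the joint range is the smaller one.
[cite: GiorgiKlainermanSzeftel2024, Step 5, p.589 L18–60; GiorgiKlainermanSzeftel2022, Step 5, l.24443–24463] -/
theorem m2r_s5_ranges (p δ : ℚ) :
    (p - 1 ≤ δ ↔ p ≤ 1 + δ) ∧ (p + 1 ≤ 2 - δ ↔ p ≤ 1 - δ) ∧ min (1 + δ) (1 - δ) = 1 - |δ| := by
  refine ⟨?_, ?_, ?_⟩
  · constructor <;> intro h <;> linarith
  · constructor <;> intro h <;> linarith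
  · rcases le_or_gt 0 δ with h | h
    · rw [abs_of_nonneg h, min_eq_right (by linarith)]
    · rw [abs_of_neg h, min_eq_left (by linarith)]; ring

/-- (12.4.15): "We infer the existence of a sequence of times `τ^{(j)}` such that, for `s ≤ k_L − 4`, `E_{1−δ}[𝓛̸_Tψ̲,
𝓛̸_TA̲](τ^{(j)}) ≲ ε₀²(τ^{(j)})^{−1+2δ}`, `τ^{(j)} ∼ 2^j`."  As printed, the rate of the time-INTEGRATED bound is kept (no
pigeonhole gain), whereas Step 8 below takes the gain (`m2r_s8`); with the gain the rate would read `−2+2δ`.  Both are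
consequences of the preceding display; the module records the printed one and what (12.4.17) then is (`m2r_12417`).
[cite: GiorgiKlainermanSzeftel2024, (12.4.15), p.589 L62–71; GiorgiKlainermanSzeftel2022, `eq:step1fluxSigamstarLiebTAbchap12:4`, l.24464–24468] -/
theorem m2r_12415 (δ : ℚ) : pigeonhole (-1 + 2 * δ) = -2 + 2 * δ ∧ -2 + 2 * δ ≤ -1 + 2 * δ := by
  simp only [pigeonhole_def]; constructor
  · ring
  · linarith

/-- Step 6, (12.4.16)–(12.4.17): "`BEF_p[𝓛̸_Tψ̲, 𝓛̸_TA̲](τ₁, τ₂) ≲ E_p[…](τ₁) + ε₀²τ₁^{−2−3δ_dec+p+δ}`" for `δ ≤ p ≤ 1−δ`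
(12.4.16); "We then apply again the standard mean value procedure starting with (12.4.16) and making use of (12.4.15) …
`BEF_δ[𝓛̸_Tψ̲, 𝓛̸_TA̲](τ₁, τ_*−2) ≲ ε₀²τ₁^{−2+4δ}`" (12.4.17).  At the top `p = 1−δ` the inhomogeneous rate `−1−3δ_dec` is
dominated by (12.4.15)'s `−1+2δ` iff `0 ≤ 3δ_dec + 2δ`; the printed `−2+4δ` is EXACTLY the descent of `−1+2δ` from `1−δ` to
`δ`; and at `p = δ` the inhomogeneous rate `−2−3δ_dec+2δ` is dominated by `−2+4δ` iff `0 ≤ 3δ_dec + 2δ`.  (With the pigeonhole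
gain in (12.4.15) the top rate would be `min`-limited by `−1−3δ_dec` and the descent would give `−2−3δ_dec+2δ`, sharper; not
printed.)
[cite: GiorgiKlainermanSzeftel2024, Step 6 (12.4.16)–(12.4.17), p.589 L74–p.590 L21; GiorgiKlainermanSzeftel2022, Step 6, l.24471–24485] -/
theorem m2r_12417 (δ δdec : ℚ) :
    (m2rInhom (1 - δ) δ δdec ≤ -1 + 2 * δ ↔ 0 ≤ 3 * δdec + 2 * δ) ∧ descend (-1 + 2 * δ) (1 - δ) δ = -2 + 4 * δ ∧
    (m2rInhom δ δ δdec ≤ -2 + 4 * δ ↔ 0 ≤ 3 * δdec + 2 * δ) ∧ descend (-1 - 3 * δdec) (1 - δ) δ = m2rInhom δ δ δdec := by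
  simp only [m2rInhom_def, descend_def]
  refine ⟨?_, by ring, ?_, by ring⟩
  · constructor <;> intro h <;> linarith
  · constructor <;> intro h <;> linarith

/-- Step 7 items 1 and 3: "`B_p[𝓛̸²_Tψ̲](τ₁, τ_*−2) ≲ ε₀²τ₁^{−2+4δ}`" (the analog of (12.4.12), from (12.4.17)) and "the analog of
(12.4.15) … `E_{1−δ}[𝓛̸²_Tψ̲, 𝓛̸²_TA̲](τ₁^{(j)}) ≲ ε₀²(τ₁^{(j)})^{−2+4δ}`" (again without the pigeonhole gain): the rate of
(12.4.17) carried unchanged, exactly as `−1+2δ` was carried from (12.4.11) to (12.4.12) and (12.4.15).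
[cite: GiorgiKlainermanSzeftel2024, Step 7 items 1–3, p.590 L23–72; GiorgiKlainermanSzeftel2022, Step 7, l.24486–24510] -/
theorem m2r_s7_carry (δ : ℚ) : descend (-2 + 4 * δ) δ δ = -2 + 4 * δ ∧ (-2 + 4 * δ) - (-1 + 2 * δ) = -1 + 2 * δ := by
  simp only [descend_def]; constructor <;> ring

/-- Step 7 item 4: "`BEF_δ[𝓛̸²_Tψ̲, 𝓛̸²_TA̲](τ₁, τ_*−2) ≲ ε₀²τ₁^{−2−2δ_dec} + ε₀²τ₁^{−2−3δ_dec+2δ} + ε₀²τ₁^{−3+6δ}`, where: the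
first term … all nonlinear terms except `𝓛̸²_TÑ_err` …, the second term … the contribution of `𝓛̸²_TÑ_err`, the last term comes
from the mean value argument."  The second exponent is (12.4.10)'s inhomogeneous rate at `p = δ`; the third is EXACTLY the
descent of item 3's `−2+4δ` from `1−δ` to `δ`.
[cite: GiorgiKlainermanSzeftel2024, Step 7 item 4, p.590 L73–p.591 L8; GiorgiKlainermanSzeftel2022, Step 7, l.24512–24522] -/
theorem m2r_s7_item4 (δ δdec : ℚ) :
    m2rInhom δ δ δdec = -2 - 3 * δdec + 2 * δ ∧ descend (-2 + 4 * δ) (1 - δ) δ = -3 + 6 * δ := by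
  simp only [m2rInhom_def, descend_def]; constructor <;> ring

/-- Step 7, conclusion: "Choosing `δ > 0` such that `2δ ≤ δ_dec`, we infer, for `s ≤ k_L − 9` and `δ_dec` small enough,
`BEF_δ[𝓛̸²_Tψ̲, 𝓛̸²_TA̲](τ₁, τ_*−2) ≲ ε₀²τ₁^{−2−2δ_dec}`."  The printed condition is EXACTLY the equivalence for the second
term; the third term is dominated iff `2δ_dec + 6δ ≤ 1`, for which, given `2δ ≤ δ_dec`, `δ_dec ≤ 1/5` suffices ("`δ_dec` small
enough").
[cite: GiorgiKlainermanSzeftel2024, Step 7, p.591 L9–13; GiorgiKlainermanSzeftel2022, Step 7, l.24523–24527] -/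
theorem m2r_s7_choice (δ δdec : ℚ) :
    (-2 - 3 * δdec + 2 * δ ≤ -2 - 2 * δdec ↔ 2 * δ ≤ δdec) ∧ (-3 + 6 * δ ≤ -2 - 2 * δdec ↔ 2 * δdec + 6 * δ ≤ 1) ∧
    (2 * δ ≤ δdec → δdec ≤ 1 / 5 → -3 + 6 * δ ≤ -2 - 2 * δdec) := by
  refine ⟨?_, ?_, ?_⟩
  · constructor <;> intro h <;> linarith
  · constructor <;> intro h <;> linarith
  · intro h1 h2; linarith

/-- Step 7's side condition against chapter 11's: §11.7.3 Steps 7 and 9 print "`δ_extra = (3δ_dec−2δ)/2 > δ_dec`", i.e. the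
STRICT `2δ < δ_dec` (`TheoremM1M2Ledger.dextraA_gt_iff`); chapter 12 prints the weak `2δ ≤ δ_dec`.  The chapter-11 condition
implies the chapter-12 one (one `δ` serves both chapters iff `2δ < δ_dec`).
[cite: GiorgiKlainermanSzeftel2024, Step 7, p.533 L2, Step 9, p.533 L37, Prop 12.4.6 Step 7, p.591 L9; GiorgiKlainermanSzeftel2022, l.22524, l.22549, l.24523] -/
theorem m2r_s7_vs_ch11 (δ δdec : ℚ) (h : δdec < dextraA δdec δ) : -2 - 3 * δdec + 2 * δ ≤ -2 - 2 * δdec := by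
  have h2 : 2 * δ < δdec := (dextraA_gt_iff δdec δ).mp h
  linarith

/-- Step 8, (12.4.18)–(12.4.19) and the end: "`B_p[𝓛̸²_TA̲](τ₁, τ_*−2) ≲ E_p[𝓛̸²_TA̲](τ₁) + ε₀²τ₁^{−2−2δ_dec}`" (12.4.18);
"`∫_{τ₁}^{τ₂}E_p[𝓛̸²_TA̲] ≲ B_{p−1}[𝓛̸²_TA̲]`.  Together with the final estimate of Step 7 for `BEF_δ` … a sequence of times
`τ₁^{(j)}` such that `E_{1+δ}[𝓛̸²_TA̲](τ₁^{(j)}) ≲ ε₀²(τ₁^{(j)})^{−3−2δ_dec}` … Plugging in (12.4.18), `B_{1+δ}[𝓛̸²_TA̲](τ₁,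
τ_*−2) ≲ ε₀²τ₁^{−2−2δ_dec}` (12.4.19).  Running again the same argument, … `E_2[𝓛̸²_TA̲](τ₂^{(j)}) ≲ ε₀²(τ₂^{(j)})^{−3−2δ_dec}`
… `B_{2−δ}[𝓛̸²_TA̲](τ₁, τ_*−2) ≲ ε₀²τ₁^{−2−2δ_dec}`, as stated."  Here the pigeonhole gain IS taken (twice): `−2−2δ_dec ↦
−3−2δ_dec`; plugged into (12.4.18) the energy term is dominated by `−2−2δ_dec`; the weights: `(1+δ) − 1 = δ`, `2 − 1 = 1 ≤ 1+δ`
iff `0 ≤ δ`, `2 − δ ≤ 2` iff `0 ≤ δ`.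
[cite: GiorgiKlainermanSzeftel2024, Step 8 (12.4.18)–(12.4.19), p.591 L14–81; GiorgiKlainermanSzeftel2022, Step 8, l.24530–24560] -/
theorem m2r_s8 (δ δdec : ℚ) :
    pigeonhole (-2 - 2 * δdec) = -3 - 2 * δdec ∧ max (-3 - 2 * δdec) (-2 - 2 * δdec) = -2 - 2 * δdec ∧
    (1 + δ) - 1 = δ ∧ ((2 : ℚ) - 1 ≤ 1 + δ ↔ 0 ≤ δ) ∧ (2 - δ ≤ (2 : ℚ) ↔ 0 ≤ δ) := by
  simp only [pigeonhole_def]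
  refine ⟨by ring, max_eq_right (by linarith), by ring, ?_, ?_⟩
  · constructor <;> intro h <;> linarith
  · constructor <;> intro h <;> linarith

/-- Prop 12.4.6 as STATED: "`B_{2−δ}[𝓛̸²_TA̲](τ₁, τ_*) ≲ ε₀²τ₁^{−2−2δ_dec}`.  Furthermore, there exists a sequence of times
`τ^{(j)}` such that … `E_2[𝓛̸²_TA̲](τ^{(j)}) ≲ ε₀²(τ^{(j)})^{−2−2δ_dec}`, `τ^{(j)} ∼ 2^j`."  Step 8 proves the sequence clause
with the better rate `−3−2δ_dec`; the statement keeps `−2−2δ_dec` (weaker by exactly the pigeonhole gain `1`).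
[cite: GiorgiKlainermanSzeftel2024, Prop 12.4.6, p.586 L12–24, Step 8, p.591 L62–73; GiorgiKlainermanSzeftel2022, Prop `prop:decayofpr2tqfb:onMMfirst`, l.24316–24326, l.24552–24554] -/
theorem m2r_statement (δdec : ℚ) : -3 - 2 * δdec ≤ -2 - 2 * δdec ∧ (-2 - 2 * δdec) - (-3 - 2 * δdec) = 1 := by
  constructor
  · linarith
  · ring

/-! ## §4 Summary of the three print data of this range (D1 both texts; D2, D3 [v1] only) -/

/-- The three print data as one statement over ℚ, for `0 < δ`, `0 ≤ δ_dec < 2`, on the printed range `δ ≤ p ≤ 1−δ`: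
(D1) the `3δ` flux display does not give the concluded `−2−2δ_extra`, (11.7.12) does;
(D2) [v1]'s `−(p+δ)` is not implied by the available total at `p = 1−δ`, [J]'s `+(p+δ)` is at every `p`;
(D3) either printed trapped rate is dominated by the far-region half-rate.
[cite: GiorgiKlainermanSzeftel2024, p.532 L80–p.533 L9, p.586 L63–p.587 L89; GiorgiKlainermanSzeftel2022, l.22517–22528, l.24341–24366] -/
theorem print_data (p δ δdec : ℚ) (hδ : 0 < δ) (hdec : 0 ≤ δdec) (hdec2 : δdec < 2) (hp : δ ≤ p) (hp' : p ≤ 1 - δ) :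
    (¬ (-(2 + 3 * δdec - 3 * δ) ≤ -2 - 2 * dextraA δdec δ) ∧ -(2 + 3 * δdec - 2 * δ) = -2 - 2 * dextraA δdec δ) ∧
    (¬ (-2 - 4 * δdec + ((1 - δ) + δ) ≤ -2 - 3 * δdec - ((1 - δ) + δ)) ∧ -2 - 4 * δdec + (p + δ) ≤ -2 - 3 * δdec + (p + δ)) ∧
    (-1 - 2 * δdec ≤ -1 - 3 / 2 * δdec + (p + δ) / 2 ∧ -2 - 3 * δdec ≤ -1 - 3 / 2 * δdec + (p + δ) / 2) := by
  simp only [dextraA_def]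
  refine ⟨⟨?_, by ring⟩, ⟨?_, by linarith⟩, ⟨by linarith, by linarith⟩⟩
  · intro h; linarith
  · intro h; linarith

end Literature.Geometry.Lorentzian.GiorgiKlainermanSzeftel2022.DecayRateLedger
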